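import Summits.BirchSwinnertonDyer.BirchSwinnertonDyer.Theorems.UniversalToricDescentAcDualMuZeroCriterion
import Summits.BirchSwinnertonDyer.BirchSwinnertonDyer.Theorems.UniversalToricDescentResidualSelmerTransport
import Summits.BirchSwinnertonDyer.BirchSwinnertonDyer.Theorems.UniversalToricDescentResidualSelmerFinite
import HarnessLib

/-!
# Route UniversalToricDescent — the residual Selmer comparison ASSEMBLED: the Greenberg–Vatsal
# transport «`X_ac^Σ(E₁)` torsion with `μ = 0` ⟹ `X_ac^Σ(E₂)` torsion with `μ = 0`» for `E₁[p] ≅ E₂[p]`,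
# modulo ONE local lemma on `E₁` (unramified ⟹ locally trivial at the good places outside `Σ`)

Lead prover bsd-wall-utd-p1 g6 (`--supports stmt-BirchSwinnertonDyer-20399`; PRICING-20399-ALG-HALF §3(a),
port-grade child B′1 `TorsionMuTransportModThree` of 20399 / `InvariantsTransportModThreeT`). Composition of
the three sibling files: `…AcDualMuZeroCriterion` (Λ-side: `Sel[p]` finite ⟺ `X` torsion, `μ = 0`, read in
`R₀⟦T⟧`), `…ResidualSelmerTransport` (`R_𝔭^Σ(K_∞, E₁[p]) ≅ R_𝔭^Σ(K_∞, E₂[p])`), `…ResidualSelmerFinite`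
(`R_𝔭^Σ(K_∞, E₂[p])` finite ⟹ `Sel_𝔭^Σ(K_∞, E₂[p^∞])[p]` finite).

* §1 `torsionToPrimaryH1Sub_mem_selmerAc_of_mem_residualSelmer`,
  **`finite_residualSelmer_of_finite_selmerAc_pTorsion`** — the twin-side half
  «`Sel_𝔭^Σ(K_∞, E[p^∞])[p]` finite ⟹ `R_𝔭^Σ(K_∞, E[p])` finite» (`p` odd) GIVEN the local lemma
  (H) «`y` unramified at the chosen place above `v` ⟹ `ι y` locally trivial there» at every `v ∉ Σ`,
  `v ∤ p`, as a HYPOTHESIS `hH` (it is `H¹(G_w/I_v, E[p^∞]) = 0`; at a place completely split in `K_∞` this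
  is "`Frob_v − 1` is onto `E[p^∞]`", at a finitely decomposed one "`G_w/I_v` has pro-order prime to `p`" —
  Greenberg–Vatsal p. 17; not yet in the tree for Castella's objects). Under (H), `ι` maps `R` into the
  `p`-torsion of `Sel` (at `∞`: `H¹(H ⊓ D_w, E[p]) = 0` for odd `p`; at `𝔭`: strict ⟹ strict), and `ι` has
  finite kernel.
* §2 **`isTorsion_and_exists_generator_transfer_of_torsionIso`** — for `W₁, W₂/K` with a `Γ_K`-equivariant
  `W₁[p] ≃+ W₂[p]`, ANY `ℤ_p`-extension `κ` of the number field `K`, `𝔭 ∋ p` with `D_𝔭 ⊄ ker κ`, a finite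
  `Σ ∌ 𝔭` containing the bad places of `W₂` prime to `p`, `p` odd, and (H) for `W₁` outside `Σ`:
  `X_ac^Σ(W₁)` torsion with `Ch·R₀⟦T⟧ = (g₁)`, `g₁` with a norm-one coefficient ⟹ the same for `X_ac^Σ(W₂)`
  — B′1's statement at a common `Σ`, modulo (H). (The route's B′1 at `Σ = ∅` additionally needs the twin's
  `Σ`-passage `∅ → Σ`, Greenberg–Vatsal Prop. 2.4 — not here.)

THEOREMS ONLY; no definition, no named fact, no `sorry`; imports no `Theses` module. BSD is not advanced.
References: [GreenbergVatsal2000] §2 pp. 17, 26, Prop. (2.8); [LimSujatha2018] §3 Prop. 3.2;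
[GreenbergLNM1716] §1, §3; [Castella2018] Def. 2.2; [SerreGaloisCohomology1997] I.§2.4.
-/

set_option autoImplicit false
-- `…BirchSwinnertonDyer.BirchSwinnertonDyer.Theorems…` is the problem's mandated namespace (D-0017).
set_option linter.dupNamespace false

noncomputable section

open scoped Classical

namespace Summit.BirchSwinnertonDyer.BirchSwinnertonDyer.Theorems.UniversalToricDescentResidualSelmerComparison

open NumberField IsDedekindDomain Field
open Literature.NumberTheory.EllipticCurves Literature.NumberTheory.EllipticCurves.GreenbergSelmer
  Literature.NumberTheory.EllipticCurves.GreenbergVatsal2000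
  Literature.NumberTheory.EllipticCurves.FineSelmerCoefficientMap
  Literature.NumberTheory.GaloisRepresentations WeierstrassCurve
  Summit.BirchSwinnertonDyer.Rank1Residual.X11b Summit.BirchSwinnertonDyer.Rank1Residual.X11b.AcSelmer
  Summit.BirchSwinnertonDyer.BirchSwinnertonDyer.Theorems.UniversalToricDescentAcDualMuZero
  Summit.BirchSwinnertonDyer.BirchSwinnertonDyer.Theorems.UniversalToricDescentResidualSelmer
  Summit.BirchSwinnertonDyer.BirchSwinnertonDyer.Theorems.UniversalToricDescentResidualSelmerFinite

variable {K : Type} [Field K] [NumberField K]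

/-! ### §1 The twin-side half modulo the local lemma (H) -/

section TwinSide

variable (W : WeierstrassCurve K) [W.IsElliptic] {p : ℕ} [Fact p.Prime] (κ : ZpExtension K p)

omit [W.IsElliptic] in
/-- **`ι(R_𝔭^Σ(K_∞, E[p])) ⊆ Sel_𝔭^Σ(K_∞, E[p^∞])` under (H)** (`p` odd, `p ∈ 𝔭`): a residual class
(unramified outside `Σ ∪ S_p` after every conjugation, strict at `𝔭`) maps under `ι = (E[p] ↪ E[p^∞])_*`
to a Selmer class — at the good `v ∉ Σ` by the hypothesis (H), at the infinite places because
`H¹(H ⊓ D_w, E[p]) = 0` for odd `p` (`subgroupH1_geomTorsion_inf_decompInf_eq_zero`), at `𝔭` because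
`ι` commutes with restriction (`resOfLe_torsionToPrimaryH1Sub`); `ι` commutes with conjugation
(`conjH1_torsionToPrimaryH1Sub`). [cite: GreenbergVatsal2000, §2 pp. 17, 26] -/
theorem torsionToPrimaryH1Sub_mem_selmerAc_of_mem_residualSelmer (hp : p ≠ 2)
    {𝔭 : HeightOneSpectrum (𝓞 K)} (h𝔭 : ((p : ℕ) : 𝓞 K) ∈ 𝔭.asIdeal) {S : Set (HeightOneSpectrum (𝓞 K))}
    (hH : ∀ v : HeightOneSpectrum (𝓞 K), v ∉ S → ((p : ℕ) : 𝓞 K) ∉ v.asIdeal →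
      ∀ y : Literature.NumberTheory.EllipticCurves.subgroupH1 κ.kerSubgroup (W.geomTorsion (p : ℤ)),
        y ∈ GreenbergVatsal2000.unramifiedKer κ.kerSubgroup (W.geomTorsion (p : ℤ)) v →
          W.torsionToPrimaryH1Sub p κ.kerSubgroup y ∈ awayKer κ.kerSubgroup (W.geomPrimaryTorsion p) v)
    {y : Literature.NumberTheory.EllipticCurves.subgroupH1 κ.kerSubgroup (W.geomTorsion (p : ℤ))}
    (hy : y ∈ datumStrictSelmer κ.kerSubgroup (W.geomTorsion (p : ℤ)) p (AcSelmer.bdpData _ p 𝔭) S) :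
    W.torsionToPrimaryH1Sub p κ.kerSubgroup y ∈ selmerAc W p κ 𝔭 S := by
  have hpodd : Odd p := (Fact.out : p.Prime).odd_of_ne_two hp
  rw [mem_datumStrictSelmer_iff, mem_unramifiedOutside_iff] at hy
  rw [selmerAc, mem_selmerOver_iff]
  refine ⟨fun v hpv hvS σ ↦ ?_, fun w σ ↦ ?_, fun σ ↦ ?_⟩
  · -- good place outside `Σ`: hypothesis (H) on the conjugate
    rw [WeierstrassCurve.conjH1_torsionToPrimaryH1Sub]
    exact hH v hvS hpv _ (hy.1 v hvS hpv σ)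
  · -- infinite place: `H¹(H ⊓ D_w, E[p]) = 0` for odd `p`
    rw [WeierstrassCurve.conjH1_torsionToPrimaryH1Sub, infKer, AddMonoidHom.mem_ker,
      resOfLe_torsionToPrimaryH1Sub]
    have h0 := subgroupH1_geomTorsion_inf_decompInf_eq_zero W hpodd κ.kerSubgroup w
      (resOfLe (↥(W.geomTorsion (p : ℤ))) (inf_le_left : κ.kerSubgroup ⊓ decompInf w ≤ κ.kerSubgroup)
        (Literature.NumberTheory.EllipticCurves.conjH1 κ.kerSubgroup (↥(W.geomTorsion (p : ℤ))) σ y))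
    rw [h0, map_zero]
  · -- the strict condition at `𝔭`
    rw [WeierstrassCurve.conjH1_torsionToPrimaryH1Sub,
      show AcSelmer.strictDatum (↥(W.geomPrimaryTorsion p)) 𝔭 =
        fineLocalDatum (↥(W.geomPrimaryTorsion p)) 𝔭 from rfl,
      mem_strictKer_fineLocalDatum_iff, resOfLe_torsionToPrimaryH1Sub]
    have h := hy.2 𝔭 h𝔭 σ
    rw [AcSelmer.bdpData_self p 𝔭 h𝔭,
      show AcSelmer.strictDatum (↥(W.geomTorsion (p : ℤ))) 𝔭 =
        fineLocalDatum (↥(W.geomTorsion (p : ℤ))) 𝔭 from rfl,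
      mem_strictKer_fineLocalDatum_iff] at h
    rw [h, map_zero]

/-- **`Sel_𝔭^Σ(K_∞, E[p^∞])[p]` finite ⟹ `R_𝔭^Σ(K_∞, E[p])` finite, given (H)** (`p` odd, `p ∈ 𝔭`):
`ι` maps `R` into the `p`-torsion of `Sel` (`torsionToPrimaryH1Sub_mem_selmerAc_of_mem_residualSelmer`,
`p_smul_torsionToPrimaryH1Sub_eq_zero`) and has finite kernel (`finite_ker_torsionToPrimaryH1Sub`).
The twin-side half of the residual comparison, reduced to the local lemma (H).
[cite: GreenbergVatsal2000, §2 p. 26] [cite: LimSujatha2018, §3 (proof of Prop. 3.2)] -/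
theorem finite_residualSelmer_of_finite_selmerAc_pTorsion (hp : p ≠ 2)
    {𝔭 : HeightOneSpectrum (𝓞 K)} (h𝔭 : ((p : ℕ) : 𝓞 K) ∈ 𝔭.asIdeal) {S : Set (HeightOneSpectrum (𝓞 K))}
    (hH : ∀ v : HeightOneSpectrum (𝓞 K), v ∉ S → ((p : ℕ) : 𝓞 K) ∉ v.asIdeal →
      ∀ y : Literature.NumberTheory.EllipticCurves.subgroupH1 κ.kerSubgroup (W.geomTorsion (p : ℤ)),
        y ∈ GreenbergVatsal2000.unramifiedKer κ.kerSubgroup (W.geomTorsion (p : ℤ)) v →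
          W.torsionToPrimaryH1Sub p κ.kerSubgroup y ∈ awayKer κ.kerSubgroup (W.geomPrimaryTorsion p) v)
    (hfin : Set.Finite {s : selmerAc W p κ 𝔭 S | p • s = 0}) :
    (datumStrictSelmer κ.kerSubgroup (W.geomTorsion (p : ℤ)) p (AcSelmer.bdpData _ p 𝔭) S :
      Set (Literature.NumberTheory.EllipticCurves.subgroupH1 κ.kerSubgroup
        (W.geomTorsion (p : ℤ)))).Finite := by
  -- the finite target: the images in `H¹(K_∞, E[p^∞])` of the `p`-torsion Selmer classes
  let T : Set (W.subgroupH1 p κ.kerSubgroup) :=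
    (fun s : selmerAc W p κ 𝔭 S ↦ (s : W.subgroupH1 p κ.kerSubgroup)) ''
      {s : selmerAc W p κ 𝔭 S | p • s = 0}
  have hT : T.Finite := hfin.image _
  have hker : (((W.torsionToPrimaryH1Sub p κ.kerSubgroup).ker : AddSubgroup
      (Literature.NumberTheory.EllipticCurves.subgroupH1 κ.kerSubgroup (W.geomTorsion (p : ℤ)))) :
      Set (Literature.NumberTheory.EllipticCurves.subgroupH1 κ.kerSubgroup
        (W.geomTorsion (p : ℤ)))).Finite :=
    W.finite_ker_torsionToPrimaryH1Sub p W.zsmul_geomPoints_surjective_holds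
  refine (AddMonoidHom.finite_preimage_of_finite_ker _ hker hT).subset fun y hy ↦ ?_
  have hmem : W.torsionToPrimaryH1Sub p κ.kerSubgroup y ∈ selmerAc W p κ 𝔭 S :=
    torsionToPrimaryH1Sub_mem_selmerAc_of_mem_residualSelmer W κ hp h𝔭 hH hy
  refine ⟨⟨W.torsionToPrimaryH1Sub p κ.kerSubgroup y, hmem⟩, ?_, rfl⟩
  change p • (⟨W.torsionToPrimaryH1Sub p κ.kerSubgroup y, hmem⟩ : selmerAc W p κ 𝔭 S) = 0
  exact Subtype.ext (by
    rw [AddSubgroupClass.coe_nsmul]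
    exact p_smul_torsionToPrimaryH1Sub_eq_zero W κ.kerSubgroup y)

end TwinSide

/-! ### §2 The transport «`X(E₁)` torsion, `μ = 0` ⟹ `X(E₂)` torsion, `μ = 0`» modulo (H) for `E₁` -/

section Transfer

variable (W₁ W₂ : WeierstrassCurve K) [W₁.IsElliptic] [W₂.IsElliptic] {p : ℕ} [Fact p.Prime]
  (κ : ZpExtension K p) (𝔭 : HeightOneSpectrum (𝓞 K)) (S : Set (HeightOneSpectrum (𝓞 K)))
  (γ : absoluteGaloisGroup K) [Fact (κ.IsTopGenerator γ)]

/-- **The Greenberg–Vatsal `μ = 0` / torsion transport along `E₁[p] ≅ E₂[p]`, modulo (H) for `E₁`.**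
`K` a number field, `κ` ANY `ℤ_p`-extension, `p` odd, `𝔭 ∋ p` finitely decomposed in `K_∞` (`D_𝔭 ⊄ ker κ`;
Brink Cor. 1 in the anticyclotomic case), `Σ` finite containing the bad places of `E₂` prime to `p`,
`e : E₁[p] ≃+ E₂[p]` `Γ_K`-equivariant, and (H) for `E₁` at every `v ∉ Σ`, `v ∤ p`. If `X_ac^Σ(E₁)` is
`Λ`-torsion with `Ch·R₀⟦T⟧ = (g₁)`, `g₁` with a norm-one coefficient, then so is `X_ac^Σ(E₂)`. Chain:
Λ-side (`finite_pTorsion_of_isTorsion_of_exists_generator`) → §1 → transport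
(`finite_residualSelmer_geomTorsion_iff_of_torsionIso`) → `finite_selmerAc_pTorsion_of_finite_residualSelmer`
→ Λ-side (`isTorsion_and_exists_generator_of_finite_pTorsion`).
[cite: GreenbergVatsal2000, §2 Prop. (2.8) and p. 26] -/
theorem isTorsion_and_exists_generator_transfer_of_torsionIso (hp : p ≠ 2)
    (h𝔭 : ((p : ℕ) : 𝓞 K) ∈ 𝔭.asIdeal) (h𝔭dec : ¬ (decomp 𝔭 ≤ κ.kerSubgroup)) (hSfin : S.Finite)
    (hS₂ : ∀ v : HeightOneSpectrum (𝓞 K), v ∉ S → ((p : ℕ) : 𝓞 K) ∉ v.asIdeal →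
      W₂.HasGoodReductionAt v)
    (e : W₁.geomTorsion (p : ℤ) ≃+ W₂.geomTorsion (p : ℤ))
    (he : ∀ (σ : absoluteGaloisGroup K) (P : W₁.geomTorsion (p : ℤ)), e (σ • P) = σ • e P)
    (hH₁ : ∀ v : HeightOneSpectrum (𝓞 K), v ∉ S → ((p : ℕ) : 𝓞 K) ∉ v.asIdeal →
      ∀ y : Literature.NumberTheory.EllipticCurves.subgroupH1 κ.kerSubgroup (W₁.geomTorsion (p : ℤ)),
        y ∈ GreenbergVatsal2000.unramifiedKer κ.kerSubgroup (W₁.geomTorsion (p : ℤ)) v →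
          W₁.torsionToPrimaryH1Sub p κ.kerSubgroup y ∈
            awayKer κ.kerSubgroup (W₁.geomPrimaryTorsion p) v)
    (hT₁ : Module.IsTorsion (IwasawaAlgebra p) (XAc W₁ p κ 𝔭 S γ))
    (hg₁ : ∃ g : UnrSeries p,
      (XAc.charIdeal W₁ p κ 𝔭 S γ).map (PowerSeries.map (Halves.toUnr p)) = Ideal.span {g} ∧
        ∃ i : ℕ, ‖((PowerSeries.coeff i g : unrIntegers p) : ℂ_[p])‖ = 1) :
    Module.IsTorsion (IwasawaAlgebra p) (XAc W₂ p κ 𝔭 S γ) ∧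
      ∃ g : UnrSeries p,
        (XAc.charIdeal W₂ p κ 𝔭 S γ).map (PowerSeries.map (Halves.toUnr p)) = Ideal.span {g} ∧
          ∃ i : ℕ, ‖((PowerSeries.coeff i g : unrIntegers p) : ℂ_[p])‖ = 1 := by
  refine torsionMuTransfer_of_finite_pTorsion_transfer p κ 𝔭 S γ W₁ W₂ hSfin (fun hfin₁ ↦ ?_) hT₁ hg₁
  have hR₁ := finite_residualSelmer_of_finite_selmerAc_pTorsion W₁ κ hp h𝔭 hH₁ hfin₁
  have hR₂ := (finite_residualSelmer_geomTorsion_iff_of_torsionIso W₁ W₂ κ 𝔭 S e he).mp hR₁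
  exact finite_selmerAc_pTorsion_of_finite_residualSelmer W₂ κ h𝔭 h𝔭dec hS₂ hR₂

end Transfer

end Summit.BirchSwinnertonDyer.BirchSwinnertonDyer.Theorems.UniversalToricDescentResidualSelmerComparison

end
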